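import Literature.NumberTheory.EllipticCurves.PadicSeriesEvaluation
import Mathlib.NumberTheory.Padics.ProperSpace
import HarnessLib

/-!
# [telescope — LEAD cruxlead-19034 g7, 2026-08-30] Brick G1 of «(F) CONSTRUCTED IN TREE»: gluing fibrewise
functions into ONE continuous `ℤ_p⟦X⟧`-valued function along the chart (interpolation from a dense set)

Crux 4 `BSDpOnCellC` (stmt-BirchSwinnertonDyer-19034), line «telescope» v19: the load-bearing cited fact T-An-2ᶠ
(`Literature.NumberTheory.EllipticCurves.hida1986_castella2020_exists_frobeniusGaloisLattice_on_pNewBranchChart`)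
asserts a framed continuous Galois lattice `π : Γ_ℚ →ₜ* GL₂(ℤ_p⟦X⟧)` whose fibres at `X = 0` and at the member points
`X = x_t` have prescribed Frobenius characteristic polynomials. Wiles' method (Invent. Math. 94 (1988), §2.2) builds such a
`π` from the MEMBERS' representations through a `ℤ_p⟦X⟧`-valued pseudo-representation; its analytic core is the following
gluing principle, made a TREE THEOREM here (pure topology of `ℤ_p⟦X⟧`, no Galois theory):

* §1 evaluation at a point `t` of the open unit disc (`evalHom t ht : ℤ_p⟦X⟧ →+* ℤ_p`, the tree's name for Mathlib's
  `PowerSeries.eval₂Hom`): `evalHom t (C a + X·G) = a + t·G(t)`, hence `‖F(t) − F(0)‖ ≤ ‖t‖` and `F(x_t) → F(0)` along any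
  null sequence (`tendsto_evalHom_constantCoeff`);
* §2 the IDENTITY PRINCIPLE along a null sequence of non-zero points: `(∀ t, F(x_t) = 0) → F = 0`
  (`eq_zero_of_forall_evalHom_eq_zero`; induction on coefficients, dividing by `X`);
* §3 `ℤ_p⟦X⟧` is COMPACT Hausdorff for the product topology and the fibre map `F ↦ (F(x_t))_t ∈ ∏_t ℤ_p` is a continuous
  injection, hence a CLOSED EMBEDDING (`isClosedEmbedding_fibres`);
* §4 GLUING (`exists_continuous_interpolant`): if `G` is a topological space with a dense subset `D`, `τ_t : G → ℤ_p`
  (`t ∈ ℕ`) are continuous, and every `d ∈ D` admits an interpolant `F_d ∈ ℤ_p⟦X⟧` with `F_d(x_t) = τ_t(d)` for all `t`,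
  then there is a UNIQUE `T : G → ℤ_p⟦X⟧`, automatically CONTINUOUS, with `T(σ)(x_t) = τ_t(σ)` for all `σ ∈ G` and all `t`;
  moreover `T(σ)(0) = τ_∞(σ)` for any continuous `τ_∞` agreeing with `F_d(0)` on `D` (`constantCoeff_interpolant`), and
  every fibrewise identity lifts to `T` (`interpolant_rel_of_fibres`: e.g. the pseudocharacter identities, class-function
  property, invariance under inertia, multiplicativity of a determinant).

In the intended use `G = Γ_ℚ`, `D` = arithmetic Frobenii off `Np` (dense: tree theorem `absoluteGaloisGroup.frobenius_dense`),
`τ_t = tr ρ_{g_t}` (the members' Deligne representations, `ℚ_p`-rational by (F-rat)), `τ_∞ = tr ρ_{E,p}`, and `F_{Frob_ℓ}` =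
the chart's `A_ℓ`. Helper toward crux 4 (`--supports`); it closes NO registered stub, changes no registered token, proves
no cited fact and no summit statement; BSD is proved for no curve.
-/

set_option autoImplicit false
set_option linter.dupNamespace false

open scoped PowerSeries.WithPiTopology Topology
open Filter PowerSeries Topology
open Literature.NumberTheory.EllipticCurves

namespace Summit.BirchSwinnertonDyer.BirchSwinnertonDyer.Theorems.TelescopeBranchTraceInterpolation

variable {p : ℕ} [Fact p.Prime]

/-! ### §1. Evaluation at a point of the open unit disc -/

/-- `X(t) = t`. [folklore] -/
theorem evalHom_X (t : ℤ_[p]) (ht : ‖t‖ < 1) : evalHom t ht X = t := by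
  rw [evalHom_apply, PowerSeries.eval₂_X]

/-- `(C a)(t) = a`. [folklore] -/
theorem evalHom_C (t : ℤ_[p]) (ht : ‖t‖ < 1) (a : ℤ_[p]) : evalHom t ht (C a) = a := by
  rw [evalHom_apply, PowerSeries.eval₂_C, RingHom.id_apply]

/-- The shift `F ↦ (F − F(0))/X` as a power series: `F = X · shift F + C (F 0)`. [folklore] -/
theorem eq_X_mul_shift_add_C (F : ℤ_[p]⟦X⟧) :
    F = X * PowerSeries.mk (fun n => coeff (n + 1) F) + C (constantCoeff F) :=
  PowerSeries.eq_X_mul_shift_add_const F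

/-- `F(t) = t · (shift F)(t) + F(0)`. [folklore] -/
theorem evalHom_eq_mul_add_constantCoeff (F : ℤ_[p]⟦X⟧) (t : ℤ_[p]) (ht : ‖t‖ < 1) :
    evalHom t ht F = t * evalHom t ht (PowerSeries.mk fun n => coeff (n + 1) F) + constantCoeff F := by
  conv_lhs => rw [eq_X_mul_shift_add_C F]
  rw [map_add, map_mul, evalHom_X, evalHom_C]

/-- The continuity estimate in the POINT: `‖F(t) − F(0)‖ ≤ ‖t‖` for `F ∈ ℤ_p⟦X⟧` (all values are `p`-adic integers).
[folklore] -/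
theorem norm_evalHom_sub_constantCoeff_le (F : ℤ_[p]⟦X⟧) (t : ℤ_[p]) (ht : ‖t‖ < 1) :
    ‖evalHom t ht F - constantCoeff F‖ ≤ ‖t‖ := by
  rw [evalHom_eq_mul_add_constantCoeff F t ht, add_sub_cancel_right, norm_mul]
  exact mul_le_of_le_one_right (norm_nonneg t) (PadicInt.norm_le_one _)

/-- Along a null sequence of points of the open unit disc, `F(x_t) → F(0)`. [folklore] -/
theorem tendsto_evalHom_constantCoeff (F : ℤ_[p]⟦X⟧) (x : ℕ → ℤ_[p]) (hx : ∀ t, ‖x t‖ < 1)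
    (hx0 : Tendsto x atTop (𝓝 0)) :
    Tendsto (fun t => evalHom (x t) (hx t) F) atTop (𝓝 (constantCoeff F)) := by
  rw [tendsto_iff_norm_sub_tendsto_zero]
  have h0 : Tendsto (fun t => ‖x t‖) atTop (𝓝 0) := by
    simpa using (tendsto_iff_norm_sub_tendsto_zero.mp hx0)
  exact squeeze_zero (fun t => norm_nonneg _) (fun t => norm_evalHom_sub_constantCoeff_le F (x t) (hx t)) h0

/-! ### §2. The identity principle along a null sequence of non-zero points -/

/-- If `F(x_t) = 0` for a null sequence of NON-ZERO points `x_t` of the open unit disc, then every coefficient of `F`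
vanishes: `F = 0`. (Induction: `F(0) = lim F(x_t) = 0`; then `F = X·F₁` with `x_t F₁(x_t) = 0`, so `F₁(x_t) = 0`.)
[folklore] -/
theorem eq_zero_of_forall_evalHom_eq_zero (x : ℕ → ℤ_[p]) (hx : ∀ t, ‖x t‖ < 1)
    (hx0 : Tendsto x atTop (𝓝 0)) (hxne : ∀ t, x t ≠ 0) (F : ℤ_[p]⟦X⟧)
    (h : ∀ t, evalHom (x t) (hx t) F = 0) : F = 0 := by
  -- all coefficients vanish, by induction on the index, uniformly in `F`
  suffices key : ∀ n : ℕ, ∀ G : ℤ_[p]⟦X⟧, (∀ t, evalHom (x t) (hx t) G = 0) → coeff n G = 0 by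
    ext n
    rw [key n F h, map_zero]
  intro n
  induction n with
  | zero =>
    intro G hG
    have hlim := tendsto_evalHom_constantCoeff G x hx hx0
    have hzero : Tendsto (fun t => evalHom (x t) (hx t) G) atTop (𝓝 0) := by
      simp only [hG]; exact tendsto_const_nhds
    have := tendsto_nhds_unique hlim hzero
    rwa [coeff_zero_eq_constantCoeff_apply]
  | succ n ih =>
    intro G hG
    -- `G(0) = 0`, so `G = X · G₁` and `G₁(x_t) = 0`
    have hG0 : constantCoeff G = 0 := by
      -- the constant coefficient vanishes as the limit of the fibre values (as in the base case)
      have hlim := tendsto_evalHom_constantCoeff G x hx hx0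
      have hzero : Tendsto (fun t => evalHom (x t) (hx t) G) atTop (𝓝 0) := by
        simp only [hG]; exact tendsto_const_nhds
      exact tendsto_nhds_unique hlim hzero
    set G₁ : ℤ_[p]⟦X⟧ := PowerSeries.mk fun m => coeff (m + 1) G with hG₁
    have hG₁ev : ∀ t, evalHom (x t) (hx t) G₁ = 0 := by
      intro t
      have e := evalHom_eq_mul_add_constantCoeff G (x t) (hx t)
      rw [hG t, hG0, add_zero] at e
      exact (mul_eq_zero.mp e.symm).resolve_left (hxne t)
    have := ih G₁ hG₁ev
    simpa [hG₁, coeff_mk] using this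

/-- Two series agreeing at a null sequence of non-zero points of the open unit disc are equal. [folklore] -/
theorem eq_of_forall_evalHom_eq (x : ℕ → ℤ_[p]) (hx : ∀ t, ‖x t‖ < 1) (hx0 : Tendsto x atTop (𝓝 0))
    (hxne : ∀ t, x t ≠ 0) (F G : ℤ_[p]⟦X⟧) (h : ∀ t, evalHom (x t) (hx t) F = evalHom (x t) (hx t) G) :
    F = G := by
  rw [← sub_eq_zero]
  exact eq_zero_of_forall_evalHom_eq_zero x hx hx0 hxne (F - G) fun t => by rw [map_sub, h t, sub_self]

/-! ### §3. Topology: `ℤ_p⟦X⟧` is compact Hausdorff and the fibre map is a closed embedding -/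

/-- `ℤ_p⟦X⟧` with the product (= `(p, X)`-adic) topology is compact (Tychonoff). [folklore] -/
theorem compactSpace_powerSeries : CompactSpace ℤ_[p]⟦X⟧ :=
  inferInstanceAs (CompactSpace ((Unit →₀ ℕ) → ℤ_[p]))

/-- Evaluation at a point of the open unit disc is continuous in the series (Mathlib `PowerSeries.continuous_eval₂`).
[folklore] -/
theorem continuous_evalHom (t : ℤ_[p]) (ht : ‖t‖ < 1) : Continuous (evalHom t ht) := by
  have h := PowerSeries.continuous_eval₂ (φ := RingHom.id ℤ_[p]) (a := t) continuous_id (padicInt_hasEval ht)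
  have e : (⇑(evalHom t ht) : ℤ_[p]⟦X⟧ → ℤ_[p]) = PowerSeries.eval₂ (RingHom.id ℤ_[p]) t := by
    funext F; exact evalHom_apply t ht F
  rw [e]; exact h

/-- The fibre map `F ↦ (t ↦ F(x_t))` is continuous (product topologies on both sides). [folklore] -/
theorem continuous_fibres (x : ℕ → ℤ_[p]) (hx : ∀ t, ‖x t‖ < 1) :
    Continuous (fun F : ℤ_[p]⟦X⟧ => fun t => evalHom (x t) (hx t) F) :=
  continuous_pi fun t => continuous_evalHom (x t) (hx t)

/-- The fibre map along a null sequence of non-zero points is injective (identity principle). [folklore] -/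
theorem injective_fibres (x : ℕ → ℤ_[p]) (hx : ∀ t, ‖x t‖ < 1) (hx0 : Tendsto x atTop (𝓝 0))
    (hxne : ∀ t, x t ≠ 0) : Function.Injective (fun F : ℤ_[p]⟦X⟧ => fun t => evalHom (x t) (hx t) F) := by
  intro F G hFG
  exact eq_of_forall_evalHom_eq x hx hx0 hxne F G fun t => congrFun hFG t

/-- The fibre map along a null sequence of non-zero points is a CLOSED EMBEDDING `ℤ_p⟦X⟧ ↪ ∏_t ℤ_p` (continuous injection
from a compact space to a Hausdorff space). [folklore] -/
theorem isClosedEmbedding_fibres (x : ℕ → ℤ_[p]) (hx : ∀ t, ‖x t‖ < 1) (hx0 : Tendsto x atTop (𝓝 0))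
    (hxne : ∀ t, x t ≠ 0) : IsClosedEmbedding (fun F : ℤ_[p]⟦X⟧ => fun t => evalHom (x t) (hx t) F) := by
  haveI := compactSpace_powerSeries (p := p)
  exact (continuous_fibres x hx).isClosedEmbedding (injective_fibres x hx hx0 hxne)

/-! ### §4. Gluing: interpolation of fibrewise continuous functions from a dense set -/

/-- **Gluing lemma.** Let `x_t` be a null sequence of non-zero points of the open unit disc of `ℤ_p`, `G` a topological
space with a dense subset `D`, and `τ_t : G → ℤ_p` (`t ∈ ℕ`) continuous functions such that every `d ∈ D` has an
interpolant `F ∈ ℤ_p⟦X⟧` with `F(x_t) = τ_t(d)` for all `t`. Then there is `T : G → ℤ_p⟦X⟧`, CONTINUOUS for the product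
topology, with `T(σ)(x_t) = τ_t(σ)` for every `σ ∈ G` and every `t`. (The range of the closed embedding `F ↦ (F(x_t))_t` is closed;
its preimage under the continuous `σ ↦ (τ_t σ)_t` is closed and contains `D`.) This is the analytic core of Wiles'
construction of Λ-adic representations from their specialisations. [cite: Wiles1988, §2.2 (the method)] [folklore] -/
theorem exists_continuous_interpolant {G : Type*} [TopologicalSpace G] {D : Set G} (hD : Dense D)
    (x : ℕ → ℤ_[p]) (hx : ∀ t, ‖x t‖ < 1) (hx0 : Tendsto x atTop (𝓝 0)) (hxne : ∀ t, x t ≠ 0)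
    (τ : ℕ → G → ℤ_[p]) (hτ : ∀ t, Continuous (τ t))
    (hint : ∀ d ∈ D, ∃ F : ℤ_[p]⟦X⟧, ∀ t, evalHom (x t) (hx t) F = τ t d) :
    ∃ T : G → ℤ_[p]⟦X⟧, Continuous T ∧ ∀ σ t, evalHom (x t) (hx t) (T σ) = τ t σ := by
  set ev : ℤ_[p]⟦X⟧ → (ℕ → ℤ_[p]) := fun F t => evalHom (x t) (hx t) F with hev
  have hemb : IsClosedEmbedding ev := isClosedEmbedding_fibres x hx hx0 hxne
  -- the tuple map `σ ↦ (τ_t σ)_t` is continuous and lands in the (closed) range of `ev` on `D`, hence everywhere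
  set Φ : G → (ℕ → ℤ_[p]) := fun σ t => τ t σ with hΦ
  have hΦc : Continuous Φ := continuous_pi fun t => hτ t
  have hrange : ∀ σ, Φ σ ∈ Set.range ev := by
    have hclosed : IsClosed (Φ ⁻¹' Set.range ev) := hemb.isClosed_range.preimage hΦc
    have hDsub : D ⊆ Φ ⁻¹' Set.range ev := by
      intro d hd
      obtain ⟨F, hF⟩ := hint d hd
      exact ⟨F, funext fun t => hF t⟩
    have huniv : Φ ⁻¹' Set.range ev = Set.univ := by
      apply Set.eq_univ_of_univ_subset
      rw [← hD.closure_eq]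
      exact closure_minimal hDsub hclosed
    intro σ
    have : σ ∈ Φ ⁻¹' Set.range ev := by rw [huniv]; exact Set.mem_univ σ
    exact this
  choose T hT using hrange
  refine ⟨T, ?_, fun σ t => ?_⟩
  · -- continuity: `ev ∘ T = Φ` is continuous and `ev` is an embedding
    rw [hemb.isEmbedding.continuous_iff]
    have e : ev ∘ T = Φ := funext fun σ => hT σ
    rw [e]; exact hΦc
  · exact congrFun (hT σ) t

/-- **Uniqueness of the interpolant**, pointwise: any `S : G → ℤ_p⟦X⟧` with the same fibre values as `T` equals `T`.
[folklore] -/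
theorem interpolant_unique {G : Type*} (x : ℕ → ℤ_[p]) (hx : ∀ t, ‖x t‖ < 1) (hx0 : Tendsto x atTop (𝓝 0))
    (hxne : ∀ t, x t ≠ 0) (τ : ℕ → G → ℤ_[p]) (T S : G → ℤ_[p]⟦X⟧)
    (hT : ∀ σ t, evalHom (x t) (hx t) (T σ) = τ t σ) (hS : ∀ σ t, evalHom (x t) (hx t) (S σ) = τ t σ) :
    S = T :=
  funext fun σ => eq_of_forall_evalHom_eq x hx hx0 hxne _ _ fun t => by rw [hS σ t, hT σ t]

/-- **The `X = 0` fibre of the interpolant.** If moreover `τ_∞ : G → ℤ_p` is continuous and agrees on `D` with the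
constant coefficients of the interpolants (i.e. `τ_∞(d) = lim_t τ_t(d)`), then `T(σ)(0) = τ_∞(σ)` for ALL `σ`.
[folklore] -/
theorem constantCoeff_interpolant {G : Type*} [TopologicalSpace G] {D : Set G} (hD : Dense D)
    (x : ℕ → ℤ_[p]) (hx : ∀ t, ‖x t‖ < 1) (hx0 : Tendsto x atTop (𝓝 0))
    (τ : ℕ → G → ℤ_[p]) (τinf : G → ℤ_[p]) (hτinf : Continuous τinf)
    (T : G → ℤ_[p]⟦X⟧) (hTc : Continuous T) (hT : ∀ σ t, evalHom (x t) (hx t) (T σ) = τ t σ)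
    (hDinf : ∀ d ∈ D, Tendsto (fun t => τ t d) atTop (𝓝 (τinf d))) :
    ∀ σ, constantCoeff (T σ) = τinf σ := by
  have hclosed : IsClosed {σ : G | constantCoeff (T σ) = τinf σ} :=
    isClosed_eq ((PowerSeries.WithPiTopology.continuous_constantCoeff (R := ℤ_[p])).comp hTc) hτinf
  have hDsub : D ⊆ {σ : G | constantCoeff (T σ) = τinf σ} := by
    intro d hd
    have hlim := tendsto_evalHom_constantCoeff (T d) x hx hx0
    have hlim' : Tendsto (fun t => evalHom (x t) (hx t) (T d)) atTop (𝓝 (τinf d)) := by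
      have e : (fun t => evalHom (x t) (hx t) (T d)) = fun t => τ t d := funext fun t => hT d t
      rw [e]; exact hDinf d hd
    exact tendsto_nhds_unique hlim hlim'
  intro σ
  have huniv : {σ : G | constantCoeff (T σ) = τinf σ} = Set.univ := by
    apply Set.eq_univ_of_univ_subset
    rw [← hD.closure_eq]
    exact closure_minimal hDsub hclosed
  have : σ ∈ {σ : G | constantCoeff (T σ) = τinf σ} := by rw [huniv]; exact Set.mem_univ σ
  exact this

/-- **Fibrewise identities lift to the interpolant** (binary form). If `Ψ : ℤ_p⟦X⟧ → ℤ_p⟦X⟧ → ℤ_p⟦X⟧` is compatible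
with every evaluation `evalHom (x t)` through maps `ψ_t : ℤ_p → ℤ_p → ℤ_p` (e.g. `Ψ = (· - ·)`, `(· * ·)`, `ψ_t` the same
operation), and the fibre values satisfy `ψ_t (T a)(x_t) (T b)(x_t) = (T c)(x_t)` for all `t`, then `Ψ (T a) (T b) = T c`.
Typical uses: `T(στ) = T(τσ)`, the `d = 2` pseudocharacter identity, `D(στ) = D(σ)D(τ)`, `T(σι) = T(σ)` for inertia `ι`.
[folklore] -/
theorem interpolant_rel_of_fibres (x : ℕ → ℤ_[p]) (hx : ∀ t, ‖x t‖ < 1) (hx0 : Tendsto x atTop (𝓝 0))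
    (hxne : ∀ t, x t ≠ 0) (Ψ : ℤ_[p]⟦X⟧ → ℤ_[p]⟦X⟧ → ℤ_[p]⟦X⟧) (ψ : ℕ → ℤ_[p] → ℤ_[p] → ℤ_[p])
    (hΨ : ∀ t F G, evalHom (x t) (hx t) (Ψ F G) = ψ t (evalHom (x t) (hx t) F) (evalHom (x t) (hx t) G))
    (A B Cc : ℤ_[p]⟦X⟧)
    (hfib : ∀ t, ψ t (evalHom (x t) (hx t) A) (evalHom (x t) (hx t) B) = evalHom (x t) (hx t) Cc) :
    Ψ A B = Cc :=
  eq_of_forall_evalHom_eq x hx hx0 hxne _ _ fun t => by rw [hΨ t, hfib t]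

/-- **Gluing with the `X = 0` fibre, packaged.** Under the hypotheses of `exists_continuous_interpolant`, plus a continuous
`τ_∞` with `τ_t(d) → τ_∞(d)` on `D`: there is a continuous `T : G → ℤ_p⟦X⟧` with `T(σ)(x_t) = τ_t(σ)` and
`T(σ)(0) = τ_∞(σ)` for all `σ`, and it is the only function with the first property. [folklore] -/
theorem exists_continuous_interpolant_with_zero_fibre {G : Type*} [TopologicalSpace G] {D : Set G} (hD : Dense D)
    (x : ℕ → ℤ_[p]) (hx : ∀ t, ‖x t‖ < 1) (hx0 : Tendsto x atTop (𝓝 0)) (hxne : ∀ t, x t ≠ 0)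
    (τ : ℕ → G → ℤ_[p]) (hτ : ∀ t, Continuous (τ t)) (τinf : G → ℤ_[p]) (hτinf : Continuous τinf)
    (hint : ∀ d ∈ D, ∃ F : ℤ_[p]⟦X⟧, ∀ t, evalHom (x t) (hx t) F = τ t d)
    (hDinf : ∀ d ∈ D, Tendsto (fun t => τ t d) atTop (𝓝 (τinf d))) :
    ∃ T : G → ℤ_[p]⟦X⟧, Continuous T ∧ (∀ σ t, evalHom (x t) (hx t) (T σ) = τ t σ) ∧
      (∀ σ, constantCoeff (T σ) = τinf σ) ∧
      ∀ S : G → ℤ_[p]⟦X⟧, (∀ σ t, evalHom (x t) (hx t) (S σ) = τ t σ) → S = T := by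
  obtain ⟨T, hTc, hT⟩ := exists_continuous_interpolant hD x hx hx0 hxne τ hτ hint
  exact ⟨T, hTc, hT, constantCoeff_interpolant hD x hx hx0 τ τinf hτinf T hTc hT hDinf,
    fun S hS => interpolant_unique x hx hx0 hxne τ T S hT hS⟩

end Summit.BirchSwinnertonDyer.BirchSwinnertonDyer.Theorems.TelescopeBranchTraceInterpolation
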